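import Literature.MathematicalPhysics.QuantumLattice.StrongExpDecayCentreSymmetry
import Literature.MathematicalPhysics.QuantumLattice.CentreSymmetryPerimeterLaw
import HarnessLib

/-!
# Chatterjee's Theorem 2.4, second assertion: exponential decay of correlations under arbitrary
# boundary conditions implies Wilson's area law (CMP 385 (2021), §12): proofs

Sibling proof file of `CentreSymmetry.lean` (same namespace). It DISCHARGES the named fact
`chatterjee2021_areaLaw_of_strongExpDecay` (S. Chatterjee, *A probabilistic mechanism for quark
confinement*, CMP **385** (2021), **Theorem 2.4**) as `chatterjee2021_areaLaw_of_strongExpDecay_holds`,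
following the printed proof of the second assertion, op. cit. §12 (chunks `p0022`–`p0023` of the held
text `paper:arxiv-2006.16229`):

* §12 ¶1–2 («its expected value in `S_{M,N}` must tend to its expected value under the unique Gibbs
  measure on the infinite slab exponentially fast in `M` … But its expected value under the Gibbs measure
  must be zero due to center symmetry and the fact that `f` transforms to `cf` under the center transform.
  This shows that the function `V` from Lemma 3.1 must have at least linear growth»):
  `colSup_le_exp_of_strongExpDecayZd` — the column kernels of the finite slabs `S_R` of a large height `n`
  are exponentially small in `R`, uniformly in the boundary condition. Rendering: Dobrushin–Shlosman's
  QUANTITATIVE window comparison under the averaged condition (`abs_integral_sub_integral_le_of_window_bulk`,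
  the tree's dual form of the slab coupling of §§8–11, instantiated with the same cube system as the
  tree's first assertion `subsingleton_slabGibbsMeasures_of_strongExpDecayZd`) compares the kernel of
  `S_R` under `η` and under the centre-transformed condition `τη` directly («`f` transforms to `cf`»:
  `γ_{S_R}(f | τη) = c γ_{S_R}(f | η)`, `slabSpecification_map_centreTransform`), which differ only on
  bottom links at spatial distance `≥ R` from the column; the depth profile is `exists_slabBox_profile`.
* (12.1) and the final interpolation («Let `a := C₄/(C₁+C₄)` …»): `chatterjee2021_areaLaw_of_strongExpDecay_holds`
  combines the tree's proof of Theorem 2.2 (`norm_integral_trace_rect_le`, with `s(R) ≤ C₃ e^{−C₄ R}`)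
  with the perimeter law, Lemma 12.3 (`chatterjee2021_perimeterLaw`). Rendering of the interpolation
  without real powers: for `R ≥ R₀` (where `m C₃ e^{−C₄R/2} ≤ 1`) and `T ≥ n` the slab bound alone gives
  `m² e^{−C₄ R T/(4n)}`; for `R < R₀` or `T < n` the perimeter law alone gives `P₁ e^{−P₂ max(R,T)}`,
  which is `≤ P₁ e^{−(P₂/max(R₀,n)) R T}` there.

The first assertion of Thm. 2.4 is the tree's `centreUnbroken_of_hasStrongExpDecayZd`. No named fact is
introduced; every statement is proved (D-0026).

## References

* S. Chatterjee, *A probabilistic mechanism for quark confinement*, Commun. Math. Phys. **385** (2021)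
  1007–1039, arXiv:2006.16229: Thm. 2.4, §12 (¶1–2, (12.1), Lemma 12.3, final display). [Chatterjee2021]
* R. L. Dobrushin, S. B. Shlosman, *Constructive criterion for the uniqueness of Gibbs field* (1985),
  Thm. 1 (exponential estimate). [DobrushinShlosman1985]
* H.-O. Georgii, *Gibbs Measures and Phase Transitions*, 2nd ed. (2011), Thm. 8.20. [Georgii2011]
-/

noncomputable section

open MeasureTheory Filter Function Finset
open scoped Topology

namespace Literature.MathematicalPhysics.QuantumLattice

open Literature.Probability.LatticeModels
open Literature.Probability.LatticeModels.DobrushinShlosman (abs_integral_sub_integral_le_of_window_bulk)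

/-! ### §0 Copies of private plumbing of the sibling files -/

/-- **The influence profile.** For `d ≥ 1`, `K₁ ≥ 0`, `K₂ > 0` and any `E₀ ≥ 0` there are `κ : ℕ → ℝ≥0` and
`A ≥ 0` with: `κ j ≥ 2` for `j ≤ 4`; `κ j ≥ E₀ · 2 · d(4r+1)^d · E₀ K₁ e^{−2K₂ r}`, `r = ⌊(j−1)/4⌋`, for `j ≥ 5`;
and `Σ_{k ≤ n} d(2k+1)^d κ k ≤ A` for every `n` (`κ j = (2 + 2dE₀²K₁)e^{2K₂}(j+1)^d e^{−K₂j/2}`, majorised by a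
summable `(k+1)^{2d} e^{−K₂k/2}` series). [folklore] -/
private theorem exists_influence_profile' {d : ℕ} (E₀ K₁ K₂ : ℝ) (hE₀ : 0 ≤ E₀) (hK₁ : 0 ≤ K₁)
    (hK₂ : 0 < K₂) :
    ∃ (κ : ℕ → ℝ) (A : ℝ), (∀ j, 0 ≤ κ j) ∧ (∀ j, j ≤ 4 → 2 ≤ κ j) ∧
      (∀ j, 5 ≤ j → E₀ * (2 * ((d * (4 * ((j - 1) / 4) + 1) ^ d : ℕ) *
        (E₀ * (K₁ * Real.exp (-(K₂ * (2 * ((j - 1) / 4 : ℕ)))))))) ≤ κ j) ∧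
      0 ≤ A ∧ ∀ n, ∑ k ∈ Finset.range (n + 1), ((d * (2 * k + 1) ^ d : ℕ) : ℝ) * κ k ≤ A := by
  set B : ℝ := (2 + 2 * d * (E₀ * E₀) * K₁) * Real.exp (2 * K₂) with hB
  have hB2 : 2 * Real.exp (2 * K₂) ≤ B := by
    rw [hB]
    refine mul_le_mul_of_nonneg_right ?_ (Real.exp_nonneg _)
    have : 0 ≤ 2 * (d : ℝ) * (E₀ * E₀) * K₁ := by positivity
    linarith
  have hB0 : 0 ≤ B := by rw [hB]; positivity
  set κ : ℕ → ℝ := fun j => B * ((j + 1 : ℕ) : ℝ) ^ d * Real.exp (-(K₂ / 2) * j) with hκ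
  have hκ0 : ∀ j, 0 ≤ κ j := fun j => by simp only [hκ]; positivity
  -- the summable majorant `M k = D (k+1)^{2d} e^{−(K₂/2) k}`
  set D : ℝ := (d : ℝ) * 2 ^ d * B with hD
  have hD0 : 0 ≤ D := by rw [hD]; positivity
  set g : ℕ → ℝ := fun m => (m : ℝ) ^ (2 * d) * Real.exp (-(K₂ / 2) * m) with hg
  have hg_sum : Summable g := Real.summable_pow_mul_exp_neg_nat_mul (2 * d) (half_pos hK₂)
  set M : ℕ → ℝ := fun k => D * Real.exp (K₂ / 2) * g (k + 1) with hM
  have hM_sum : Summable M := ((summable_nat_add_iff 1).2 hg_sum).mul_left _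
  have hM0 : ∀ k, 0 ≤ M k := fun k => by simp only [hM, hg]; positivity
  -- termwise domination of the received-sum series by `M`
  have hterm : ∀ k : ℕ, ((d * (2 * k + 1) ^ d : ℕ) : ℝ) * κ k ≤ M k := by
    intro k
    have h1 : ((2 * k + 1 : ℕ) : ℝ) ^ d ≤ (2 : ℝ) ^ d * ((k + 1 : ℕ) : ℝ) ^ d := by
      rw [← mul_pow]
      exact pow_le_pow_left₀ (by positivity) (by push_cast; linarith) d
    have h2 : Real.exp (-(K₂ / 2) * k) = Real.exp (K₂ / 2) * Real.exp (-(K₂ / 2) * ((k + 1 : ℕ) : ℝ)) := by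
      rw [← Real.exp_add]; congr 1; push_cast; ring
    have h3 : ((k + 1 : ℕ) : ℝ) ^ d * ((k + 1 : ℕ) : ℝ) ^ d = ((k + 1 : ℕ) : ℝ) ^ (2 * d) := by
      rw [← pow_add]; congr 1; ring
    simp only [hM, hg, hD, hκ]
    push_cast
    have hk1 : (0 : ℝ) ≤ (k : ℝ) + 1 := by positivity
    calc ((d : ℝ) * (2 * (k : ℝ) + 1) ^ d) * (B * ((k : ℝ) + 1) ^ d * Real.exp (-(K₂ / 2) * k))
        ≤ ((d : ℝ) * ((2 : ℝ) ^ d * ((k : ℝ) + 1) ^ d)) * (B * ((k : ℝ) + 1) ^ d * Real.exp (-(K₂ / 2) * k)) := by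
          refine mul_le_mul_of_nonneg_right (mul_le_mul_of_nonneg_left ?_ (Nat.cast_nonneg d)) (by positivity)
          have := h1; push_cast at this; exact this
      _ = (d : ℝ) * 2 ^ d * B * Real.exp (K₂ / 2) *
            (((k : ℝ) + 1) ^ (2 * d) * Real.exp (-(K₂ / 2) * ((k : ℝ) + 1))) := by
          have e2 : Real.exp (-(K₂ / 2) * k) = Real.exp (K₂ / 2) * Real.exp (-(K₂ / 2) * ((k : ℝ) + 1)) := by
            rw [← Real.exp_add]; congr 1; ring
          have e3 : ((k : ℝ) + 1) ^ d * ((k : ℝ) + 1) ^ d = ((k : ℝ) + 1) ^ (2 * d) := by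
            rw [← pow_add]; congr 1; ring
          rw [e2, ← e3]; ring
      _ = _ := by ring
  refine ⟨κ, ∑' k, M k, hκ0, fun j hj => ?_, fun j hj => ?_, tsum_nonneg hM0, fun n => ?_⟩
  · -- near shells: `κ j ≥ 2`
    simp only [hκ]
    have hj' : (j : ℝ) ≤ 4 := by exact_mod_cast hj
    have hpow : (1 : ℝ) ≤ ((j + 1 : ℕ) : ℝ) ^ d := one_le_pow₀ (by push_cast; linarith)
    have hexp : Real.exp (2 * K₂) * Real.exp (-(K₂ / 2) * j) ≥ 1 := by
      rw [← Real.exp_add]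
      exact Real.one_le_exp (by nlinarith)
    calc (2 : ℝ) ≤ 2 * Real.exp (2 * K₂) * 1 * Real.exp (-(K₂ / 2) * j) := by nlinarith [Real.exp_pos (-(K₂ / 2) * j)]
      _ ≤ B * ((j + 1 : ℕ) : ℝ) ^ d * Real.exp (-(K₂ / 2) * j) := by
          refine mul_le_mul_of_nonneg_right (mul_le_mul hB2 hpow zero_le_one hB0) (Real.exp_nonneg _)
  · -- far shells: Cor. 7.4's bound with `r = ⌊(j−1)/4⌋`
    set r : ℕ := (j - 1) / 4 with hr
    have h4r : 4 * r + 1 ≤ j + 1 := by omega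
    have h4r' : j ≤ 4 * r + 4 := by omega
    simp only [hκ]
    have hpow : ((d * (4 * r + 1) ^ d : ℕ) : ℝ) ≤ (d : ℝ) * ((j + 1 : ℕ) : ℝ) ^ d := by
      have : (d * (4 * r + 1) ^ d : ℕ) ≤ d * (j + 1) ^ d :=
        Nat.mul_le_mul_left d (Nat.pow_le_pow_left h4r d)
      exact_mod_cast this
    have hexp : Real.exp (-(K₂ * (2 * (r : ℕ)))) ≤ Real.exp (2 * K₂) * Real.exp (-(K₂ / 2) * j) := by
      rw [← Real.exp_add]
      refine Real.exp_le_exp.2 ?_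
      have : (j : ℝ) ≤ 4 * r + 4 := by exact_mod_cast h4r'
      nlinarith
    calc E₀ * (2 * (((d * (4 * r + 1) ^ d : ℕ) : ℝ) * (E₀ * (K₁ * Real.exp (-(K₂ * (2 * (r : ℕ))))))))
        = 2 * (E₀ * E₀) * K₁ * (((d * (4 * r + 1) ^ d : ℕ) : ℝ)) * Real.exp (-(K₂ * (2 * (r : ℕ)))) := by ring
      _ ≤ 2 * (E₀ * E₀) * K₁ * ((d : ℝ) * ((j + 1 : ℕ) : ℝ) ^ d) *
            (Real.exp (2 * K₂) * Real.exp (-(K₂ / 2) * j)) :=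
          mul_le_mul (mul_le_mul_of_nonneg_left hpow (by positivity)) hexp (Real.exp_nonneg _) (by positivity)
      _ = (2 * d * (E₀ * E₀) * K₁ * Real.exp (2 * K₂)) * ((j + 1 : ℕ) : ℝ) ^ d * Real.exp (-(K₂ / 2) * j) := by
          ring
      _ ≤ B * ((j + 1 : ℕ) : ℝ) ^ d * Real.exp (-(K₂ / 2) * j) := by
          refine mul_le_mul_of_nonneg_right (mul_le_mul_of_nonneg_right ?_ (by positivity)) (Real.exp_nonneg _)
          rw [hB]
          refine mul_le_mul_of_nonneg_right (by linarith) (Real.exp_nonneg _)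
  · -- the partial sums are bounded by the sum of the majorant
    calc ∑ k ∈ Finset.range (n + 1), ((d * (2 * k + 1) ^ d : ℕ) : ℝ) * κ k
        ≤ ∑ k ∈ Finset.range (n + 1), M k := Finset.sum_le_sum fun k _ => hterm k
      _ ≤ ∑' k, M k := hM_sum.sum_le_tsum _ fun k _ => hM0 k



section Cubes

variable {d : ℕ}

/-- Membership in the interior link set of a cube, unfolded. [folklore] -/
private theorem mem_cubeInterior_iff'' {v : Fin d → ℤ} {n : ℕ} {Λ : Finset (ZdEdge d)}
    (hΛ : Λ = (((Fintype.piFinset fun j : Fin d => Finset.Icc (v j) (v j + n)) ×ˢ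
        (Finset.univ : Finset (Fin d))).filter fun e =>
          e.1 e.2 + 1 ≤ v e.2 + n ∧ ∀ j, j ≠ e.2 → v j < e.1 j ∧ e.1 j < v j + n))
    (u : ZdEdge d) :
    u ∈ Λ ↔ (∀ j, v j ≤ u.1 j ∧ u.1 j ≤ v j + n) ∧ u.1 u.2 + 1 ≤ v u.2 + n ∧
      ∀ j, j ≠ u.2 → v j < u.1 j ∧ u.1 j < v j + n := by
  classical
  rw [hΛ]
  simp only [Finset.mem_filter, Finset.mem_product, Fintype.mem_piFinset, Finset.mem_Icc,
    Finset.mem_univ, and_true]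

/-- Membership in the link set of a cube, unfolded. [folklore] -/
private theorem mem_cubeEdges_iff'' {v : Fin d → ℤ} {n : ℕ} {E : Finset (ZdEdge d)}
    (hE : E = (((Fintype.piFinset fun j : Fin d => Finset.Icc (v j) (v j + n)) ×ˢ
        (Finset.univ : Finset (Fin d))).filter fun e => e.1 e.2 + 1 ≤ v e.2 + n))
    (u : ZdEdge d) :
    u ∈ E ↔ (∀ j, v j ≤ u.1 j ∧ u.1 j ≤ v j + n) ∧ u.1 u.2 + 1 ≤ v u.2 + n := by
  classical
  rw [hE]
  simp only [Finset.mem_filter, Finset.mem_product, Fintype.mem_piFinset, Finset.mem_Icc,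
    Finset.mem_univ, and_true]

/-- Spatial sup-distance control between a link of a cube and an interior link of the same cube. [folklore] -/
private theorem natAbs_le_of_mem_cube' [NeZero d] {n : ℕ} {c x e : ZdEdge d}
    (hx : ∀ j, (fun j : Fin d => if j = 0 then (0 : ℤ) else c.1 j - 1) j ≤ x.1 j ∧
      x.1 j ≤ (fun j : Fin d => if j = 0 then (0 : ℤ) else c.1 j - 1) j + n)
    (he : ∀ j, (fun j : Fin d => if j = 0 then (0 : ℤ) else c.1 j - 1) j ≤ e.1 j ∧
      e.1 j ≤ (fun j : Fin d => if j = 0 then (0 : ℤ) else c.1 j - 1) j + n)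
    {j : Fin d} (hj : j ≠ 0) : (e.1 j).natAbs ≤ (x.1 j).natAbs + n ∧ (x.1 j).natAbs ≤ (e.1 j).natAbs + n ∧
      (c.1 j).natAbs ≤ (x.1 j).natAbs + n + 1 := by
  have h1 := hx j
  have h2 := he j
  simp only [if_neg hj] at h1 h2
  refine ⟨?_, ?_, ?_⟩ <;> omega

/-! ### §1 The depth profile of the finite slab `S_R` for the cube windows -/

/-- A link with small spatial coordinates lies in the slab box. [folklore] -/
private theorem mem_slabBox_of_natAbs_le [NeZero d] {n R : ℕ} {e : ZdEdge d} (he : IsSlabInteriorEdge n e)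
    (hsp : ∀ j : Fin d, j ≠ 0 → (e.1 j).natAbs + 2 ≤ R) : e ∈ slabBox n R := by
  refine mem_slabBox.2 ⟨he, fun k hk => ?_, fun k hk => ?_⟩
  · have h := hsp k hk
    have habs : |e.1 k| = ((e.1 k).natAbs : ℤ) := (Int.natCast_natAbs _).symm
    omega
  · have h := hsp k hk
    have habs : |e.1 k| = ((e.1 k).natAbs : ℤ) := (Int.natCast_natAbs _).symm
    have h1 : |(e.1 + Pi.single e.2 (1 : ℤ) : Site d) k| ≤ |e.1 k| + 1 := by
      rw [Pi.add_apply]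
      refine (abs_add_le _ _).trans (add_le_add_right ?_ _)
      by_cases hke : k = e.2
      · subst hke; simp
      · simp [Pi.single_eq_of_ne hke]
    omega

/-- ★ **The depth profile of `S_R`** (the quantitative form of the exhaustion `exists_slab_exhaustion_profile`,
Chatterjee 2021 §12 ¶2: «exponentially fast in `M`»). Window system: `win c` = interior of the cube
`b(c) + {0,…,n}^d` for interior slab links `c` (`n ≥ 1`), `∅` otherwise; `nbhd c` = the links of that cube,
resp. `∅`; an array `K` supported in `x ∈ win c`, `y ∈ nbhd c`. For the finite slab `Λ = slabBox n R` the profile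
`ℓ(x) = ⌊(R − 1 − max_{j≠0} |x_j|)/(n+2)⌋` has: windows around links of positive profile have centre and window
in `Λ`, and their cubes leave `Λ` only through links that are NOT interior slab links (the frozen temporal
faces); `ℓ` drops by at most one from `x ∈ win c` to any `y ∈ nbhd c`; `ℓ = ⌊(R−1)/(n+2)⌋` on the central
column. [cite: Chatterjee2021, §12] -/
theorem exists_slabBox_profile [NeZero d] {n : ℕ} (hn : 1 ≤ n)
    (win nbhd : ZdEdge d → Finset (ZdEdge d)) (K : ZdEdge d → ZdEdge d → ZdEdge d → ℝ)
    (hwin : ∀ c, win c = if IsSlabInteriorEdge n c then (((Fintype.piFinset fun j : Fin d =>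
        Finset.Icc ((fun j : Fin d => if j = 0 then (0 : ℤ) else c.1 j - 1) j)
          ((fun j : Fin d => if j = 0 then (0 : ℤ) else c.1 j - 1) j + n)) ×ˢ
        (Finset.univ : Finset (Fin d))).filter fun e =>
          e.1 e.2 + 1 ≤ (fun j : Fin d => if j = 0 then (0 : ℤ) else c.1 j - 1) e.2 + n ∧
          ∀ j, j ≠ e.2 → (fun j : Fin d => if j = 0 then (0 : ℤ) else c.1 j - 1) j < e.1 j ∧
            e.1 j < (fun j : Fin d => if j = 0 then (0 : ℤ) else c.1 j - 1) j + n) else ∅)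
    (hnbhd : ∀ c, nbhd c = if IsSlabInteriorEdge n c then (((Fintype.piFinset fun j : Fin d =>
        Finset.Icc ((fun j : Fin d => if j = 0 then (0 : ℤ) else c.1 j - 1) j)
          ((fun j : Fin d => if j = 0 then (0 : ℤ) else c.1 j - 1) j + n)) ×ˢ
        (Finset.univ : Finset (Fin d))).filter fun e =>
          e.1 e.2 + 1 ≤ (fun j : Fin d => if j = 0 then (0 : ℤ) else c.1 j - 1) e.2 + n) else ∅)
    (hK : ∀ c y x, K c y x ≠ 0 → x ∈ win c ∧ y ∈ nbhd c) (R : ℕ) :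
    ∃ ℓ : ZdEdge d → ℕ,
      (∀ x, ℓ x ≠ 0 → ∀ c, x ∈ win c → c ∈ slabBox n R ∧ win c ⊆ slabBox n R ∧
        ∀ v ∈ nbhd c, v ∉ slabBox n R → v ∉ {e : ZdEdge d | IsSlabInteriorEdge n e}) ∧
      (∀ c x y, x ∈ win c → K c y x ≠ 0 → ℓ x ≤ ℓ y + 1) ∧
      (∀ x ∈ colEdges (0 : Site d) n, (R - 1) / (n + 2) ≤ ℓ x) := by
  classical
  -- the spatial sup norm (as a natural number)
  set Sp : ZdEdge d → ℕ := fun e => Finset.univ.sup fun j : Fin d => if j = 0 then 0 else (e.1 j).natAbs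
    with hSp
  have hSp_le : ∀ (e : ZdEdge d) (m : ℕ), (∀ j, j ≠ 0 → (e.1 j).natAbs ≤ m) → Sp e ≤ m := by
    intro e m h
    refine Finset.sup_le fun j _ => ?_
    by_cases hj : j = 0
    · simp [hj]
    · simp only [if_neg hj]; exact h j hj
  have hle_Sp : ∀ (e : ZdEdge d) (j : Fin d), j ≠ 0 → (e.1 j).natAbs ≤ Sp e := by
    intro e j hj
    have := Finset.le_sup (f := fun j : Fin d => if j = 0 then 0 else (e.1 j).natAbs) (Finset.mem_univ j)
    simp only [if_neg hj] at this
    exact this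
  set ℓ : ZdEdge d → ℕ := fun e => (R - 1 - Sp e) / (n + 2) with hℓ
  -- geometry of a window: centre, interior links and cube links versus a link `x` of the window
  have hgeom : ∀ c x, x ∈ win c → IsSlabInteriorEdge n c ∧ Sp c ≤ Sp x + n + 1 ∧
      (∀ e ∈ win c, IsSlabInteriorEdge n e ∧ Sp e ≤ Sp x + n) ∧
      (∀ e ∈ nbhd c, Sp e ≤ Sp x + n ∧ Sp x ≤ Sp e + n) := by
    intro c x hx
    by_cases hc : IsSlabInteriorEdge n c
    · rw [hwin c, if_pos hc] at hx
      have hx' := (mem_cubeInterior_iff'' rfl x).1 hx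
      refine ⟨hc, hSp_le c _ fun j hj => ?_, fun e he => ?_, fun e he => ?_⟩
      · exact ((natAbs_le_of_mem_cube' (e := x) hx'.1 hx'.1 hj).2.2).trans (by
          have := hle_Sp x j hj; omega)
      · rw [hwin c, if_pos hc] at he
        have he' := (mem_cubeInterior_iff'' rfl e).1 he
        refine ⟨isSlabInteriorEdge_of_mem_cubeInterior (v := fun j : Fin d =>
          if j = 0 then (0 : ℤ) else c.1 j - 1) (by simp) rfl he, hSp_le e _ fun j hj => ?_⟩
        exact (natAbs_le_of_mem_cube' hx'.1 he'.1 hj).1.trans (by have := hle_Sp x j hj; omega)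
      · rw [hnbhd c, if_pos hc] at he
        have he' := (mem_cubeEdges_iff'' rfl e).1 he
        refine ⟨hSp_le e _ fun j hj => ?_, hSp_le x _ fun j hj => ?_⟩
        · exact (natAbs_le_of_mem_cube' hx'.1 he'.1 hj).1.trans (by have := hle_Sp x j hj; omega)
        · exact (natAbs_le_of_mem_cube' hx'.1 he'.1 hj).2.1.trans (by have := hle_Sp e j hj; omega)
    · rw [hwin c, if_neg hc] at hx
      exact absurd hx (Finset.notMem_empty x)
  have hmem : ∀ e : ZdEdge d, IsSlabInteriorEdge n e → Sp e + 2 ≤ R → e ∈ slabBox n R :=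
    fun e he hs => mem_slabBox_of_natAbs_le he fun j hj => by have := hle_Sp e j hj; omega
  refine ⟨ℓ, ?_, ?_, ?_⟩
  · -- windows around links of positive profile
    intro x hx c hxc
    obtain ⟨hc, hSc, hwinc, hnbhdc⟩ := hgeom c x hxc
    have hLx : Sp x + n + 2 ≤ R - 1 := by
      by_contra h
      apply hx
      simp only [hℓ]
      apply Nat.div_eq_of_lt
      omega
    refine ⟨hmem c hc (by omega), fun e he => hmem e (hwinc e he).1 (by have := (hwinc e he).2; omega),
      fun v hv hvΛ hvW => hvΛ (hmem v hvW (by have := (hnbhdc v hv).1; omega))⟩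
  · -- the profile moves by at most one inside a cube
    intro c x y hxc hKc
    obtain ⟨-, hy⟩ := hK c y x hKc
    obtain ⟨-, -, -, hnbhdc⟩ := hgeom c x hxc
    have h := (hnbhdc y hy).1
    simp only [hℓ]
    have h1 : R - 1 - Sp x ≤ (R - 1 - Sp y) + (n + 2) := by omega
    calc (R - 1 - Sp x) / (n + 2) ≤ ((R - 1 - Sp y) + (n + 2)) / (n + 2) := Nat.div_le_div_right h1
      _ = (R - 1 - Sp y) / (n + 2) + 1 := Nat.add_div_right _ (by omega)
  · -- full depth on the central column
    intro x hx
    obtain ⟨t, -, rfl⟩ := mem_colEdges.1 hx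
    have hS0 : Sp ((0 : Site d) + Pi.single 0 (t : ℤ), (0 : Fin d)) = 0 := by
      refine le_antisymm (hSp_le _ 0 fun j hj => ?_) (Nat.zero_le _)
      simp [Pi.single_eq_of_ne hj]
    simp only [hℓ, hS0, Nat.sub_zero, le_refl]

end Cubes

/-! ### §2 The finite-slab kernels forget the far boundary condition exponentially fast -/

section SlabKernel

variable {d N : ℕ} {G : Type*} [Group G] [TopologicalSpace G] [IsTopologicalGroup G]
  [CompactSpace G] [MeasurableSpace G] [BorelSpace G] [SecondCountableTopology G] [T2Space G] [NeZero d]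
  (ρ : G →* Matrix (Fin N) (Fin N) ℂ)

/-- ★ **Chatterjee 2021, §12 ¶1–2, quantitative form: the kernels of the finite slabs `S_R` forget the
boundary condition on the interior slab links exponentially fast in `R`.** For every compact metrisable `G`,
continuous `ρ` with `|Re tr ρ(U_p)| ≤ C`, and Def. 2.3 with constants `K₁`, `K₂ > 0`, there is a height `n₀` such
that for every `n ≥ n₀` there is `κ > 0` with: for all `R ≥ 1`, all boundary conditions `ω, η` that agree on the
non-interior links (the frozen temporal faces), and every bounded measurable observable `F` of the central column
`colEdges 0 n` with site-Lipschitz vector `δ` supported on the column,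
`|γ_{S_R}(F | ω) − γ_{S_R}(F | η)| ≤ 2 e^{−κ ⌊(R−1)/(n+2)⌋} Σ_{x ∈ col} δ x`, `S_R = slabBox n R`
(printed: «if `f` is a bounded measurable function of `{ω_e}_{e∈A}` … then `|∫ f dμ − ∫ f dμ'|` falls off
exponentially in the distance of `A` from the spatial boundary of `S_{M,N}`»). Proof: Dobrushin–Shlosman's
exponential estimate under the averaged condition `C_V` (`DobrushinShlosman.abs_integral_sub_integral_le_of_window_bulk`)
for the system of all full-height cubes of side `n` of the slab — the same data ((H1) from
`abs_integral_sub_integral_le_cube_influence`, locality `integral_ymSpecification_cube_congr`, the averaged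
received sum `sum_cover_boundary_influence_le` against `le_card_cover`) as in the tree's first assertion
`subsingleton_slabGibbsMeasures_of_strongExpDecayZd` — with the depth profile `exists_slabBox_profile`.
[cite: Chatterjee2021, Thm. 2.4 (proof, §12 ¶1–2)] -/
theorem exists_slabBox_kernel_decay (hρ : Continuous ρ) {C : ℝ} (hC0 : 0 ≤ C)
    (hC : ∀ (x : Site d) (i j : Fin d) (U : LGConfig d G), |plaquetteObs ρ x i j U| ≤ C)
    {β K₁ K₂ : ℝ} (hdecay : StrongExpDecayZd d ρ β K₁ K₂) (hK₂ : 0 < K₂) :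
    ∃ n₀ : ℕ, 1 ≤ n₀ ∧ ∀ n, n₀ ≤ n → ∃ κ₀ : ℝ, 0 < κ₀ ∧
      ∀ (R : ℕ), 1 ≤ R → ∀ (ω η : LGConfig d G), (∀ e, ¬ IsSlabInteriorEdge n e → ω e = η e) →
        ∀ (F : LGConfig d G → ℝ), Measurable F → ∀ (B : ℝ), (∀ σ, |F σ| ≤ B) →
          DependsOn F (↑(colEdges (0 : Site d) n) : Set (ZdEdge d)) →
          ∀ (δ : ZdEdge d → ℝ), (∀ x, 0 ≤ δ x) → (∀ x, x ∉ colEdges (0 : Site d) n → δ x = 0) →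
            (∀ (x : ZdEdge d) (σ τ : LGConfig d G), (∀ e, e ≠ x → σ e = τ e) → |F σ - F τ| ≤ δ x) →
            |∫ U, F U ∂(ymSpecification ρ β (slabBox n R) ω) -
                ∫ U, F U ∂(ymSpecification ρ β (slabBox n R) η)| ≤
              2 * Real.exp (-(κ₀ * (((R - 1) / (n + 2) : ℕ) : ℝ))) * ∑ x ∈ colEdges (0 : Site d) n, δ x := by
  classical
  have hd : 0 < d := Nat.pos_of_ne_zero (NeZero.ne d)
  have hK₁ : 0 ≤ K₁ := hdecay.nonneg
  -- the influence profile
  set E₀ : ℝ := Real.exp (2 * (|β| * (2 * C * (2 * (d - 1 : ℕ) : ℕ)))) with hE₀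
  obtain ⟨κ, A, hκ0, hκ2, hκE, hA0, hA⟩ :=
    exists_influence_profile' (d := d) E₀ K₁ K₂ (Real.exp_nonneg _) hK₁ hK₂
  -- the height threshold
  set M₀ : ℝ := 4 * d * ((d - 1 : ℕ) : ℝ) * 2 ^ (d - 1) * A with hM₀
  have hM₀0 : 0 ≤ M₀ := by rw [hM₀]; positivity
  refine ⟨⌈M₀⌉₊ + 3, by omega, fun n hn => ?_⟩
  have hn3 : 3 ≤ n := by omega
  have hn2 : 2 ≤ n := by omega
  have hn1 : 1 ≤ n := by omega
  have hnM : M₀ ≤ (n : ℝ) - 1 := by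
    have h1 : (⌈M₀⌉₊ : ℝ) + 3 ≤ n := by exact_mod_cast hn
    have h2 : M₀ ≤ ⌈M₀⌉₊ := Nat.le_ceil M₀
    linarith
  -- metric bookkeeping on `G` (`val = id`, Urysohn's metric, bounded by compactness)
  let cubeInt : ZdEdge d → Finset (ZdEdge d) := fun c => (((Fintype.piFinset fun j : Fin d =>
      Finset.Icc ((fun j : Fin d => if j = 0 then (0 : ℤ) else c.1 j - 1) j)
        ((fun j : Fin d => if j = 0 then (0 : ℤ) else c.1 j - 1) j + n)) ×ˢ
      (Finset.univ : Finset (Fin d))).filter fun e =>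
        e.1 e.2 + 1 ≤ (fun j : Fin d => if j = 0 then (0 : ℤ) else c.1 j - 1) e.2 + n ∧
        ∀ j, j ≠ e.2 → (fun j : Fin d => if j = 0 then (0 : ℤ) else c.1 j - 1) j < e.1 j ∧
          e.1 j < (fun j : Fin d => if j = 0 then (0 : ℤ) else c.1 j - 1) j + n)
  let cubeEdges : ZdEdge d → Finset (ZdEdge d) := fun c => (((Fintype.piFinset fun j : Fin d =>
      Finset.Icc ((fun j : Fin d => if j = 0 then (0 : ℤ) else c.1 j - 1) j)
        ((fun j : Fin d => if j = 0 then (0 : ℤ) else c.1 j - 1) j + n)) ×ˢ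
      (Finset.univ : Finset (Fin d))).filter fun e =>
        e.1 e.2 + 1 ≤ (fun j : Fin d => if j = 0 then (0 : ℤ) else c.1 j - 1) e.2 + n)
  let win : ZdEdge d → Finset (ZdEdge d) := fun c => if IsSlabInteriorEdge n c then cubeInt c else ∅
  let nbhd : ZdEdge d → Finset (ZdEdge d) := fun c => if IsSlabInteriorEdge n c then cubeEdges c else ∅
  let K : ZdEdge d → ZdEdge d → ZdEdge d → ℝ := fun c y x =>
    if IsSlabInteriorEdge n c ∧ x ∈ cubeInt c ∧ y ∉ cubeInt c ∧ y ∈ cubeEdges c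
    then κ ⌊‖x.1 - y.1‖⌋₊ else 0
  let cover : ZdEdge d → Finset (ZdEdge d) := fun x => ((Fintype.piFinset fun j : Fin d =>
      if j = 0 then Finset.Icc (0 : ℤ) n else Finset.Icc (x.1 j + 1 - n) (x.1 j + 1)) ×ˢ
    (Finset.univ : Finset (Fin d))).filter fun c => IsSlabInteriorEdge n c ∧ x ∈ win c
  have hwin_pos : ∀ c, IsSlabInteriorEdge n c → win c = cubeInt c := fun c hc => if_pos hc
  have hnbhd_pos : ∀ c, IsSlabInteriorEdge n c → nbhd c = cubeEdges c := fun c hc => if_pos hc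
  have hwin_neg : ∀ c, ¬ IsSlabInteriorEdge n c → win c = ∅ := fun c hc => if_neg hc
  have hint_sub_edges : ∀ c, cubeInt c ⊆ cubeEdges c := by
    intro c u hu
    simp only [cubeInt, cubeEdges, Finset.mem_filter] at hu ⊢
    exact ⟨hu.1, hu.2.1⟩
  have hKwin : ∀ c y x, K c y x ≠ 0 → IsSlabInteriorEdge n c ∧ x ∈ win c ∧ y ∈ nbhd c ∧ y ∉ win c := by
    intro c y x hK
    by_cases h : IsSlabInteriorEdge n c ∧ x ∈ cubeInt c ∧ y ∉ cubeInt c ∧ y ∈ cubeEdges c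
    · rw [hwin_pos c h.1, hnbhd_pos c h.1]
      exact ⟨h.1, h.2.1, h.2.2.2, h.2.2.1⟩
    · exact absurd (if_neg h) hK
  -- the specification and the two measures
  have hγ := QuantumFieldTheory.isSpecification_ymSpecification_of_t2Space (d := d) ρ hρ β
  -- constant observables have equal averages under any two kernels
  have hconst : ∀ (Λ : Finset (ZdEdge d)) (ζ ζ' : LGConfig d G) (f : LGConfig d G → ℝ),
      DependsOn f ((∅ : Finset (ZdEdge d)) : Set (ZdEdge d)) →
      ∫ U, f U ∂(ymSpecification ρ β Λ ζ) = ∫ U, f U ∂(ymSpecification ρ β Λ ζ') := by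
    intro Λ ζ ζ' f hf
    haveI := hγ.isProbability Λ ζ
    haveI := hγ.isProbability Λ ζ'
    have hc : ∀ U, f U = f ζ := fun U => hf (by simp)
    rw [show (fun U => f U) = fun _ => f ζ from funext hc]
    simp
  -- the rate and the data of one comparison
  refine ⟨(1 - 1 / 2) ^ 2 / (2 * (2 * (((2 * d * (d - 1) * (n + 1) ^ (d - 1) : ℕ) : ℝ) * A) + 1)),
    by positivity, fun R hR ω₀ η₀ hωη₀ F hFm B₀ hB₀ hFdep δ₀ hδ₀0 hδ₀col hlip₀ => ?_⟩
  obtain ⟨ℓ, hUℓ, hℓ, hcolℓ⟩ := exists_slabBox_profile hn1 win nbhd K (fun c => rfl) (fun c => rfl)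
    (fun c y x hK => ⟨(hKwin c y x hK).2.1, (hKwin c y x hK).2.2.1⟩) R
  have hsumeq : ∑ x ∈ slabBox n R, δ₀ x = ∑ x ∈ colEdges (0 : Site d) n, δ₀ x :=
    (Finset.sum_subset (colEdges_zero_subset_slabBox hR) fun x _ hx => hδ₀col x hx).symm
  have hδ' : DobrushinMetric.IsLipBound (fun _ _ : G => (1 : ℝ)) F δ₀ :=
    ⟨hδ₀0, fun x σ τ h => by rw [mul_one]; exact hlip₀ x σ τ h⟩
  have key := abs_integral_sub_integral_le_of_window_bulk hγ (r := fun _ _ => (1 : ℝ)) (R := 1)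
    (fun _ _ => zero_le_one) (fun _ _ => le_rfl) zero_le_one (win := win) (nbhd := nbhd) (K := K)
    ?hK0 ?hKsupp ?hcontract ?hloc {e | IsSlabInteriorEdge n e} cover ?hcover
    (γ₀ := 1 / 2) (Γ := (2 * d * (d - 1) * (n + 1) ^ (d - 1) : ℕ) * A) (by norm_num) (by norm_num)
    (by positivity) ?hsum0 ?hsum (slabBox n R) (fun e he => (mem_slabBox.1 (Finset.mem_coe.1 he)).1) ?hself
    ω₀ η₀ ℓ ((R - 1) / (n + 2))
    (fun x hx c hxc => ⟨(hUℓ x hx c hxc).1, (hUℓ x hx c hxc).2.1,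
      fun v hv hvΛ => hωη₀ v ((hUℓ x hx c hxc).2.2 v hv hvΛ)⟩)
    hℓ hFm hB₀
    (fun U V h => hFdep fun e he =>
      h e (Finset.mem_coe.2 (colEdges_zero_subset_slabBox hR (Finset.mem_coe.1 he))))
    hδ' (fun x hx => hδ₀col x fun hxcol => absurd (hcolℓ x hxcol) (not_le.2 hx))
  case _ =>
    rw [mul_one, hsumeq] at key
    exact key
  case hK0 =>
    intro c y x
    simp only [K]
    split_ifs
    · exact hκ0 _
    · exact le_rfl
  case hKsupp =>
    intro c y x hK
    exact (hKwin c y x hK).2.2.1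
  case hcontract =>
    intro c y hy ω η hωη f δ' hfm hfB hfdep hδ0 hlip
    rw [mul_one]
    obtain ⟨B, hB⟩ := hfB
    have hlip' : ∀ (x : ZdEdge d) (σ τ : LGConfig d G), (∀ e, e ≠ x → σ e = τ e) → |f σ - f τ| ≤ δ' x :=
      fun x σ τ h => by simpa using hlip x σ τ h
    by_cases hc : IsSlabInteriorEdge n c
    · rw [hwin_pos c hc] at hy hfdep ⊢
      have key := abs_integral_sub_integral_le_cube_influence ρ hρ hC0 hC hdecay hK₂.le n
        (fun j : Fin d => if j = 0 then (0 : ℤ) else c.1 j - 1) (cubeInt c) rfl κ hκ0 hκ2 hκE y hy ω η hωη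
        hfm hB hfdep hδ0 hlip'
      refine key.trans (le_of_eq (Finset.sum_congr rfl fun x hx => ?_))
      congr 1
      simp only [K]
      by_cases hyE : y ∈ cubeEdges c
      · have hyE' : (∀ j, (fun j : Fin d => if j = 0 then (0 : ℤ) else c.1 j - 1) j ≤ y.1 j ∧
            y.1 j ≤ (fun j : Fin d => if j = 0 then (0 : ℤ) else c.1 j - 1) j + n) ∧
            y.1 y.2 + 1 ≤ (fun j : Fin d => if j = 0 then (0 : ℤ) else c.1 j - 1) y.2 + n := by
          simpa only [cubeEdges, Finset.mem_filter, Finset.mem_product, Fintype.mem_piFinset, Finset.mem_Icc,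
            Finset.mem_univ, and_true] using hyE
        rw [if_pos hyE', if_pos ⟨hc, hx, hy, hyE⟩]
      · have hyE' : ¬ ((∀ j, (fun j : Fin d => if j = 0 then (0 : ℤ) else c.1 j - 1) j ≤ y.1 j ∧
            y.1 j ≤ (fun j : Fin d => if j = 0 then (0 : ℤ) else c.1 j - 1) j + n) ∧
            y.1 y.2 + 1 ≤ (fun j : Fin d => if j = 0 then (0 : ℤ) else c.1 j - 1) y.2 + n) := by
          simpa only [cubeEdges, Finset.mem_filter, Finset.mem_product, Fintype.mem_piFinset, Finset.mem_Icc,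
            Finset.mem_univ, and_true] using hyE
        rw [if_neg hyE', if_neg (fun h => hyE h.2.2.2)]
    · rw [hwin_neg c hc] at hfdep ⊢
      rw [hconst _ ω η f hfdep, sub_self, abs_zero, Finset.sum_empty]
  case hloc =>
    intro c ζ ζ' hζ f hfm hfB hfdep
    by_cases hc : IsSlabInteriorEdge n c
    · rw [hwin_pos c hc] at hfdep ⊢
      rw [hnbhd_pos c hc] at hζ
      refine integral_ymSpecification_cube_congr ρ hρ β rfl hfm hfdep fun u hu1 hu2 => hζ u ?_
      simp only [cubeEdges, Finset.mem_filter, Finset.mem_product, Fintype.mem_piFinset, Finset.mem_Icc,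
        Finset.mem_univ, and_true]
      exact ⟨hu1, hu2⟩
    · rw [hwin_neg c hc] at hfdep ⊢
      exact hconst _ ζ ζ' f hfdep
  case hself =>
    intro c hc
    have hc' : IsSlabInteriorEdge n c := (mem_slabBox.1 hc).1
    rw [hwin_pos c hc']
    exact self_mem_cubeInterior_base hn2 hc' rfl
  case hcover =>
    intro c x
    exact mem_cover_iff n win cover (fun c => rfl) (fun x => rfl) c x
  case hsum0 =>
    intro x
    have h := sum_cover_boundary_influence_le hκ0 n x win nbhd cover K hwin_pos hnbhd_pos
      (fun c y hc hxc hyc => by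
        rw [hwin_pos c hc] at hxc ⊢
        rw [hnbhd_pos c hc] at hyc
        simp only [K]
        by_cases hyi : y ∈ cubeInt c
        · rw [if_neg (fun h => h.2.2.1 hyi), if_neg (not_not.2 hyi)]
        · rw [if_pos ⟨hc, hxc, hyi, hyc⟩, if_pos hyi]) rfl
    refine (le_of_eq ?_).trans (h.trans (mul_le_mul_of_nonneg_left (hA n) (Nat.cast_nonneg _)))
    rfl
  case hsum =>
    intro x
    have h := sum_cover_boundary_influence_le hκ0 n x win nbhd cover K hwin_pos hnbhd_pos
      (fun c y hc hxc hyc => by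
        rw [hwin_pos c hc] at hxc ⊢
        rw [hnbhd_pos c hc] at hyc
        simp only [K]
        by_cases hyi : y ∈ cubeInt c
        · rw [if_neg (fun h => h.2.2.1 hyi), if_neg (not_not.2 hyi)]
        · rw [if_pos ⟨hc, hxc, hyi, hyc⟩, if_pos hyi]) rfl
    by_cases hxW : IsSlabInteriorEdge n x
    · -- the averaged bound against the number of windows around `x`
      have hcard := le_card_cover hn2 win cover (fun c => rfl) (fun x => rfl) hxW
      refine (le_of_eq rfl).trans (h.trans ((mul_le_mul_of_nonneg_left (hA n) (Nat.cast_nonneg _)).trans ?_))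
      have hcard' : (((n - 1) ^ d : ℕ) : ℝ) ≤ (cover x).card := by exact_mod_cast hcard
      refine le_trans ?_ (mul_le_mul_of_nonneg_left hcard' (by norm_num))
      -- `2d(d−1)(n+1)^{d−1} A ≤ (n−1)^d / 2` for `n − 1 ≥ 2^{d+1} d (d−1) A`, `n ≥ 3`
      have hn1' : (1 : ℝ) ≤ n := by exact_mod_cast hn1
      have e1 : (((n - 1) ^ d : ℕ) : ℝ) = ((n : ℝ) - 1) ^ d := by
        rw [Nat.cast_pow, Nat.cast_sub hn1]; push_cast; ring
      rw [e1]
      obtain ⟨d', hd'⟩ : ∃ d', d = d' + 1 := ⟨d - 1, by omega⟩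
      have hdsub : d - 1 = d' := by omega
      rw [hdsub]
      push_cast
      rw [hd', pow_succ]
      have hn3' : (3 : ℝ) ≤ n := by exact_mod_cast hn3
      have h2 : ((n : ℝ) + 1) ^ d' ≤ (2 : ℝ) ^ d' * ((n : ℝ) - 1) ^ d' := by
        rw [← mul_pow]
        exact pow_le_pow_left₀ (by positivity) (by linarith) d'
      have h3 : 0 ≤ ((n : ℝ) - 1) ^ d' := pow_nonneg (by linarith) d'
      have hd'c : ((d' + 1 : ℕ) : ℝ) = (d' : ℝ) + 1 := by push_cast; ring
      rw [hM₀, hdsub, hd'] at hnM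
      have h4 : 2 * ((d' : ℝ) + 1) * (d' : ℝ) * ((n : ℝ) + 1) ^ d' * A ≤
          2 * ((d' : ℝ) + 1) * (d' : ℝ) * ((2 : ℝ) ^ d' * ((n : ℝ) - 1) ^ d') * A :=
        mul_le_mul_of_nonneg_right (mul_le_mul_of_nonneg_left h2 (by positivity)) hA0
      push_cast at hnM
      have h5 : 2 * ((d' : ℝ) + 1) * (d' : ℝ) * ((2 : ℝ) ^ d' * ((n : ℝ) - 1) ^ d') * A =
          (4 * ((d' : ℝ) + 1) * (d' : ℝ) * 2 ^ d' * A) * ((n : ℝ) - 1) ^ d' / 2 := by ring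
      rw [hd'c]
      calc 2 * ((d' : ℝ) + 1) * (d' : ℝ) * ((n : ℝ) + 1) ^ d' * A
          ≤ (4 * ((d' : ℝ) + 1) * (d' : ℝ) * 2 ^ d' * A) * ((n : ℝ) - 1) ^ d' / 2 := h4.trans (le_of_eq h5)
        _ ≤ ((n : ℝ) - 1) * ((n : ℝ) - 1) ^ d' / 2 := by
            have := mul_le_mul_of_nonneg_right hnM h3
            linarith
        _ = 1 / 2 * (((n : ℝ) - 1) ^ d' * ((n : ℝ) - 1)) := by ring
    · -- a link outside the free region lies in no window
      have hempty : cover x = ∅ := by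
        refine Finset.eq_empty_of_forall_notMem fun c hc => hxW ?_
        have hxc : x ∈ win c := (mem_cover_iff n win cover (fun c => rfl) (fun x => rfl) c x).2 hc
        by_cases hc : IsSlabInteriorEdge n c
        · rw [hwin_pos c hc] at hxc
          exact isSlabInteriorEdge_of_mem_cubeInterior (v := fun j : Fin d =>
            if j = 0 then (0 : ℤ) else c.1 j - 1) (by simp) rfl hxc
        · rw [hwin_neg c hc] at hxc
          exact absurd hxc (Finset.notMem_empty x)
      rw [hempty]
      simp

end SlabKernel

/-! ### §3 Linear growth of `V`: the column kernels of the finite slabs are exponentially small -/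

section ColumnDecay

variable {d N m : ℕ} [NeZero d] {G : Type*} [Group G] [TopologicalSpace G] [IsTopologicalGroup G]
  [CompactSpace G] [T2Space G] [SecondCountableTopology G] [MeasurableSpace G] [BorelSpace G]
  (ρ : G →* Matrix (Fin N) (Fin N) ℂ) (π : G →* Matrix (Fin m) (Fin m) ℂ)

omit [T2Space G] in
/-- The centre transform maps the kernel of the finite slab `S_R` with boundary condition `η` to the kernel
with boundary condition `τη` (all links of `S_R` are interior slab links; `slabSpecification_map_centreTransform`).
[cite: Chatterjee2021, §2.3 (τ is a symmetry of the specification)] -/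
theorem ymSpecification_slabBox_map_centreTransform (hρ : Continuous ρ) {g₀ : G}
    (hg₀ : g₀ ∈ Subgroup.center G) (β : ℝ) (n R : ℕ) (η : LGConfig d G) :
    (ymSpecification ρ β (slabBox n R) η).map (centreTransform g₀) =
      ymSpecification ρ β (slabBox n R) (centreTransform g₀ η) := by
  have h := slabSpecification_map_centreTransform ρ hρ hg₀ β n (slabBox n R) η
  have hf : (slabBox n R).filter (IsSlabInteriorEdge (d := d) n) = slabBox n R :=
    Finset.filter_true_of_mem fun e he => (mem_slabBox.1 he).1
  simpa only [slabSpecification, hf] using h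

omit [T2Space G] in
/-- **«`f` transforms to `cf` under the center transform»** (Chatterjee 2021 §12 ¶2, §3): the column kernel
of the finite slab `S_R` under the boundary condition `τη` is `c` times the one under `η`, for a column of
height `n ≥ 1` through the bottom layer and `π(g₀) = c·1`. [cite: Chatterjee2021, §12 (¶2)] -/
theorem integral_colMat_slabBox_centreTransform (hρ : Continuous ρ) (hπ : Continuous π) {g₀ : G}
    (hg₀ : g₀ ∈ Subgroup.center G) {c : ℂ} (hc : π g₀ = c • (1 : Matrix (Fin m) (Fin m) ℂ)) (β : ℝ)
    {n : ℕ} (hn : 1 ≤ n) (R : ℕ) (η : LGConfig d G) (a b : Fin m) :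
    ∫ U, colMat π U 0 n a b ∂(ymSpecification ρ β (slabBox n R) (centreTransform g₀ η)) =
      c * ∫ U, colMat π U 0 n a b ∂(ymSpecification ρ β (slabBox n R) η) := by
  obtain ⟨n', rfl⟩ : ∃ n', n = n' + 1 := ⟨n - 1, by omega⟩
  have hcont : Continuous fun U : LGConfig d G => colMat π U 0 (n' + 1) a b :=
    (continuous_apply b).comp ((continuous_apply a).comp (continuous_colMat π hπ (n' + 1) 0))
  rw [← ymSpecification_slabBox_map_centreTransform ρ hρ hg₀ β (n' + 1) R η,
    integral_map (measurable_centreTransform g₀).aemeasurable hcont.aestronglyMeasurable]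
  have hτ : ∀ U : LGConfig d G, colMat π (centreTransform g₀ U) 0 (n' + 1) a b =
      c * colMat π U 0 (n' + 1) a b := fun U => by
    rw [colMat_centreTransform π hc U (y := 0) rfl n', Matrix.smul_apply, smul_eq_mul]
  simp_rw [hτ]
  exact integral_const_mul _ _

/-- ★ **Chatterjee 2021, §12 ¶2: under exponential decay of correlations the function `V` of Lemma 3.1 has at
least linear growth** — the column kernels of the finite slabs `S_R` (height `n`, the DS height of
`exists_slabBox_kernel_decay`) satisfy `s(R) = sup_{η,a,b} |γ_{S_R}(col_{ab} | η)| ≤ C₃ e^{−C₄ R}` for all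
`R ≥ 1`, with `C₄ > 0`. Printed proof, followed on the finite slab: the kernels under `η` and under the
centre-transformed condition `τη` differ by the factor `c ≠ 1` («`f` transforms to `cf`»,
`integral_colMat_slabBox_centreTransform`), while `τη` and `η` differ only on bottom links at spatial distance
`≥ R` from the column, so the two kernel values differ by `≤ 8n e^{−κ₀⌊(R−1)/(n+2)⌋}`
(`exists_slabBox_kernel_decay`, applied to the real and imaginary parts); hence
`|c − 1| · s(R) ≤ 8n e^{−κ₀⌊(R−1)/(n+2)⌋}`. [cite: Chatterjee2021, Thm. 2.4 (proof, §12 ¶2)] -/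
theorem colSup_le_exp_of_strongExpDecayZd (hρ : Continuous ρ) (hπ : Continuous π)
    (hπu : ∀ g, π g ∈ Matrix.unitaryGroup (Fin m) ℂ) {β K₁ K₂ : ℝ}
    (hdecay : StrongExpDecayZd d ρ β K₁ K₂) (hK₂ : 0 < K₂) {g₀ : G} (hg₀ : g₀ ∈ Subgroup.center G)
    {c : ℂ} (hc : π g₀ = c • (1 : Matrix (Fin m) (Fin m) ℂ)) (hc1 : c ≠ 1) :
    ∃ n : ℕ, 1 ≤ n ∧ ∃ C₃ C₄ : ℝ, 0 ≤ C₃ ∧ 0 < C₄ ∧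
      ∀ R : ℕ, 1 ≤ R → colSup d ρ π β n R ≤ C₃ * Real.exp (-(C₄ * R)) := by
  obtain ⟨C, hC0, hC⟩ := exists_forall_abs_plaquetteObs_le (d := d) ρ hρ
  obtain ⟨n, hn, hdec⟩ := exists_slabBox_kernel_decay ρ hρ hC0 hC hdecay hK₂
  obtain ⟨κ₀, hκ₀, hker⟩ := hdec n le_rfl
  have hc1' : 0 < ‖c - 1‖ := norm_pos_iff.2 (sub_ne_zero.2 hc1)
  haveI : ∀ (Λ' : Finset (ZdEdge d)) (ζ : LGConfig d G), IsProbabilityMeasure (ymSpecification ρ β Λ' ζ) :=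
    isProbabilityMeasure_ymSpecification ρ hρ β
  refine ⟨n, hn, 8 * n * Real.exp κ₀ / ‖c - 1‖, κ₀ / (n + 2), by positivity, by positivity,
    fun R hR => ?_⟩
  -- the Lipschitz vector of a column observable
  set δ : ZdEdge d → ℝ := fun x => if x ∈ colEdges (0 : Site d) n then 2 else 0 with hδ
  have hδ0 : ∀ x, 0 ≤ δ x := fun x => by simp only [hδ]; split_ifs <;> norm_num
  have hδcol : ∀ x, x ∉ colEdges (0 : Site d) n → δ x = 0 := fun x hx => by simp only [hδ, if_neg hx]
  have hδsum : ∑ x ∈ colEdges (0 : Site d) n, δ x ≤ 2 * n := by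
    rw [Finset.sum_congr rfl fun x hx => show δ x = 2 from if_pos hx, Finset.sum_const, nsmul_eq_mul,
      mul_comm]
    refine mul_le_mul_of_nonneg_left ?_ (by norm_num)
    have h : (colEdges (0 : Site d) n).card ≤ n := by
      unfold colEdges
      exact Finset.card_image_le.trans (by simp)
    exact_mod_cast h
  -- depth arithmetic: `⌊(R−1)/(n+2)⌋ ≥ R/(n+2) − 1`
  set L : ℕ := (R - 1) / (n + 2) with hL
  have hLR : Real.exp (-(κ₀ * L)) ≤ Real.exp κ₀ * Real.exp (-(κ₀ / (n + 2) * R)) := by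
    rw [← Real.exp_add]
    refine Real.exp_le_exp.2 ?_
    have h0 : R ≤ L * (n + 2) + (n + 2) := by
      have h1 := Nat.div_add_mod (R - 1) (n + 2)
      have h2 := Nat.mod_lt (R - 1) (show 0 < n + 2 by omega)
      rw [← hL] at h1
      have : (n + 2) * L = L * (n + 2) := mul_comm _ _
      omega
    have h1 : (R : ℝ) ≤ (L : ℝ) * (n + 2) + (n + 2) := by exact_mod_cast h0
    have hn2 : (0 : ℝ) < n + 2 := by positivity
    have h2 : κ₀ / (n + 2) * R ≤ κ₀ * L + κ₀ := by
      rw [div_mul_eq_mul_div, div_le_iff₀ hn2]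
      nlinarith [h1, hκ₀]
    linarith
  -- the bound for each kernel entry
  have key : ∀ (η : LGConfig d G) (a b : Fin m),
      ‖∫ U, colMat π U 0 n a b ∂(ymSpecification ρ β (slabBox n R) η)‖ ≤
        8 * n * Real.exp κ₀ / ‖c - 1‖ * Real.exp (-(κ₀ / (n + 2) * R)) := by
    intro η a b
    set I : LGConfig d G → ℂ := fun ζ => ∫ U, colMat π U 0 n a b ∂(ymSpecification ρ β (slabBox n R) ζ)
      with hI
    have hcont : Continuous fun U : LGConfig d G => colMat π U 0 n a b :=
      (continuous_apply b).comp ((continuous_apply a).comp (continuous_colMat π hπ n 0))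
    have hbd : ∀ U : LGConfig d G, ‖colMat π U 0 n a b‖ ≤ 1 := fun U => norm_colMat_apply_le_one π hπu U 0 n a b
    have hint : ∀ ζ, Integrable (fun U : LGConfig d G => colMat π U 0 n a b) (ymSpecification ρ β (slabBox n R) ζ) :=
      fun ζ => Integrable.of_bound hcont.aestronglyMeasurable 1 (ae_of_all _ hbd)
    -- «f transforms to cf»
    have hIτ : I (centreTransform g₀ η) = c * I η :=
      integral_colMat_slabBox_centreTransform ρ π hρ hπ hg₀ hc β hn R η a b
    -- `τη` and `η` agree on the frozen faces
    have hagree : ∀ e, ¬ IsSlabInteriorEdge n e → centreTransform g₀ η e = η e := fun e he =>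
      centreTransform_apply_of_neg g₀ η fun h => he (isSlabInteriorEdge_of_bottom hn h)
    -- real and imaginary parts are column observables with Lipschitz vector `δ`
    have hdep : DependsOn (fun U : LGConfig d G => colMat π U 0 n a b) (↑(colEdges (0 : Site d) n)) :=
      isCylinder_colMat_apply π 0 n a b
    have hparts : ∀ (pr : ℂ → ℝ), Continuous pr → (∀ z, |pr z| ≤ ‖z‖) →
        |∫ U, pr (colMat π U 0 n a b) ∂(ymSpecification ρ β (slabBox n R) (centreTransform g₀ η)) -
            ∫ U, pr (colMat π U 0 n a b) ∂(ymSpecification ρ β (slabBox n R) η)| ≤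
          2 * Real.exp (-(κ₀ * L)) * (2 * n) := by
      intro pr hpr hprn
      have h := hker R hR _ _ hagree (fun U => pr (colMat π U 0 n a b)) (hpr.comp hcont).measurable 1
        (fun U => (hprn _).trans (hbd U)) (fun U V hUV => congrArg pr (hdep hUV)) δ hδ0 hδcol
        (fun x σ τ hστ => by
          by_cases hx : x ∈ colEdges (0 : Site d) n
          · simp only [hδ, if_pos hx]
            have h1 := (hprn _).trans (hbd σ)
            have h2 := (hprn _).trans (hbd τ)
            rw [abs_le] at h1 h2 ⊢
            constructor <;> linarith
          · simp only [hδ, if_neg hx]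
            have hστ' : colMat π σ 0 n a b = colMat π τ 0 n a b :=
              hdep fun e he => hστ e fun hex => hx (hex ▸ Finset.mem_coe.1 he)
            rw [hστ', sub_self, abs_zero])
      exact h.trans (mul_le_mul_of_nonneg_left hδsum (by positivity))
    have hre := hparts Complex.re Complex.continuous_re fun z => Complex.abs_re_le_norm z
    have him := hparts Complex.im Complex.continuous_im fun z => Complex.abs_im_le_norm z
    -- `‖I(τη) − I(η)‖ ≤ |Re| + |Im| ≤ 8 n e^{−κ₀ L}`
    have hre' : (I (centreTransform g₀ η) - I η).re =
        ∫ U, (colMat π U 0 n a b).re ∂(ymSpecification ρ β (slabBox n R) (centreTransform g₀ η)) -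
          ∫ U, (colMat π U 0 n a b).re ∂(ymSpecification ρ β (slabBox n R) η) := by
      have h1 := integral_re (hint (centreTransform g₀ η))
      have h2 := integral_re (hint η)
      simp only [RCLike.re_to_complex] at h1 h2
      rw [Complex.sub_re, hI, ← h1, ← h2]
    have him' : (I (centreTransform g₀ η) - I η).im =
        ∫ U, (colMat π U 0 n a b).im ∂(ymSpecification ρ β (slabBox n R) (centreTransform g₀ η)) -
          ∫ U, (colMat π U 0 n a b).im ∂(ymSpecification ρ β (slabBox n R) η) := by
      have h1 := integral_im (hint (centreTransform g₀ η))
      have h2 := integral_im (hint η)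
      simp only [RCLike.im_to_complex] at h1 h2
      rw [Complex.sub_im, hI, ← h1, ← h2]
    have hdiff : ‖I (centreTransform g₀ η) - I η‖ ≤ 8 * n * Real.exp (-(κ₀ * L)) := by
      refine (Complex.norm_le_abs_re_add_abs_im _).trans ?_
      rw [hre', him']
      linarith [hre, him]
    have hnorm : ‖c - 1‖ * ‖I η‖ ≤ 8 * n * Real.exp (-(κ₀ * L)) := by
      rw [← norm_mul, sub_mul, one_mul, ← hIτ]
      exact hdiff
    calc ‖I η‖ = ‖c - 1‖ * ‖I η‖ / ‖c - 1‖ := by field_simp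
      _ ≤ 8 * n * Real.exp (-(κ₀ * L)) / ‖c - 1‖ := div_le_div_of_nonneg_right hnorm hc1'.le
      _ ≤ 8 * n * (Real.exp κ₀ * Real.exp (-(κ₀ / (n + 2) * R))) / ‖c - 1‖ :=
          div_le_div_of_nonneg_right (mul_le_mul_of_nonneg_left hLR (by positivity)) hc1'.le
      _ = 8 * n * Real.exp κ₀ / ‖c - 1‖ * Real.exp (-(κ₀ / (n + 2) * R)) := by ring
  exact Real.iSup_le (fun p => key p.1 p.2.1 p.2.2) (by positivity)

end ColumnDecay

/-! ### §4 Chatterjee's Theorem 2.4, second assertion: the area law -/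

section Assembly

variable {d N m : ℕ} [NeZero d] {G : Type*} [Group G] [TopologicalSpace G] [IsTopologicalGroup G]
  [CompactSpace G] [T2Space G] [SecondCountableTopology G] [MeasurableSpace G] [BorelSpace G]
  (ρ : G →* Matrix (Fin N) (Fin N) ℂ) (π : G →* Matrix (Fin m) (Fin m) ℂ)

omit [NeZero d] [CompactSpace G] [T2Space G] [SecondCountableTopology G] [MeasurableSpace G]
  [BorelSpace G] in
/-- `lineHol` depends continuously on the configuration. [folklore] -/
private theorem continuous_lineHol'' (i : Fin d) :
    ∀ (n : ℕ) (y : Site d), Continuous fun U : LGConfig d G => lineHol U i n y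
  | 0, y => by simp only [lineHol_zero]; exact continuous_const
  | n + 1, y => by
      simp only [lineHol_succ]
      exact (continuous_apply _).mul (continuous_lineHol'' i n _)

omit [NeZero d] [CompactSpace G] [T2Space G] [SecondCountableTopology G] [MeasurableSpace G]
  [BorelSpace G] in
/-- The Wilson loop observable of a rectangle is continuous in the configuration. [folklore] -/
private theorem continuous_trace_rect'' (hπ : Continuous π) (x : Site d) (i j : Fin d) (R T : ℕ) :
    Continuous fun U : LGConfig d G => (π (walkHolonomy U (rectWalk x i j R T))).trace := by
  simp only [walkHolonomy_rectWalk]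
  refine (hπ.comp ?_).matrix_trace
  exact (((continuous_lineHol'' _ R _).mul (continuous_lineHol'' _ T _)).mul
    (continuous_lineHol'' _ R _).inv).mul (continuous_lineHol'' _ T _).inv

/-- ★★ **Chatterjee 2021, Theorem 2.4 (second assertion), for every compact gauge group: exponential decay of
correlations under arbitrary boundary conditions implies Wilson's area law.** If the lattice Yang–Mills theory
of a continuous representation `ρ` of the compact metrisable group `G` satisfies Def. 2.3
(`HasStrongExpDecayZd d ρ β`) and `π` is a continuous finite-dimensional irreducible unitary representation
acting non-trivially on the centre, then there are `C₁, C₂ > 0` (depending on `G, ρ, β, π, d` only) with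
`|⟨tr π(U_ℓ)⟩_μ| ≤ C₁ e^{−C₂ RT}` for every DLR state `μ` and every rectangular loop with sides `R, T ≥ 1`.
Proof as printed (§12): Schur (`π(g₀) = c·1`, `c ≠ 1`); linear growth of `V`
(`colSup_le_exp_of_strongExpDecayZd`: `s(R) ≤ C₃ e^{−C₄R}` for the slabs of a DS height `n`); the proof of
Thm. 2.2 (`norm_integral_trace_rect_le`: `|⟨W_ℓ⟩| ≤ m^{[T/n]+2} s(R)^{[T/n]}` after moving the `T`-side to
`e₀` by a coordinate permutation, `map_relabel_edgePerm_mem_ymGibbsMeasures`) — this is (12.1); the perimeter law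
Lemma 12.3 (`chatterjee2021_perimeterLaw`); and the final interpolation, rendered without real powers: for
`T ≥ n` and `R ≥ R₀` (`m C₃ e^{−C₄R} ≤ e^{−C₄R/2}`) the slab bound gives `m² e^{−C₄ R T/(4n)}`, otherwise
the perimeter law gives `P₁ e^{−P₂(R+T)} ≤ P₁ e^{−(P₂/max(n,R₀)) RT}`.
[cite: Chatterjee2021, Thm. 2.4 (proof, §12)] -/
theorem areaLaw_of_hasStrongExpDecayZd (hρ : Continuous ρ) {β : ℝ} (hdecay : HasStrongExpDecayZd d ρ β)
    (hπ : Continuous π) (hπu : ∀ g, π g ∈ Matrix.unitaryGroup (Fin m) ℂ)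
    (hirr : Literature.Analysis.Convex.SymmetryAdapted.IsIrrep π)
    (hg₀ : ∃ g₀ ∈ Subgroup.center G, π g₀ ≠ 1) :
    ∃ C₁ C₂ : ℝ, 0 < C₁ ∧ 0 < C₂ ∧ ∀ μ ∈ ymGibbsMeasures ρ β,
      ∀ (x : Site d) (i j : Fin d), i ≠ j → ∀ (R T : ℕ), 1 ≤ R → 1 ≤ T →
        ‖∫ U, (π (walkHolonomy U (rectWalk x i j R T))).trace ∂μ‖ ≤
          C₁ * Real.exp (-(C₂ * ((R : ℝ) * T))) := by
  obtain ⟨g₀, hg₀c, hg₀ne⟩ := hg₀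
  obtain ⟨K₁, K₂, -, hK₂, hdec⟩ := hdecay
  -- Schur's lemma: `π(g₀) = c • 1` with `c ≠ 1`
  obtain ⟨c, hc⟩ := Literature.Analysis.Convex.SymmetryAdapted.exists_eq_smul_one_of_comm hirr
    (M := π g₀) fun g => by rw [← map_mul, ← map_mul, Subgroup.mem_center_iff.1 hg₀c g]
  have hc1 : c ≠ 1 := fun h => hg₀ne (by rw [hc, h, one_smul])
  have hm : 1 ≤ m := by
    rcases Nat.eq_zero_or_pos m with h | h
    · subst h; exact absurd (Subsingleton.elim _ _) hg₀ne
    · exact h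
  have hmpos : (0 : ℝ) < m := by exact_mod_cast hm
  -- §12 ¶2: `V` has linear growth
  obtain ⟨n, hn, C₃, C₄, hC₃, hC₄, hcol⟩ :=
    colSup_le_exp_of_strongExpDecayZd ρ π hρ hπ hπu hdec hK₂ hg₀c hc hc1
  have hn0 : (0 : ℝ) < n := by exact_mod_cast hn
  -- Lemma 12.3: the perimeter law
  obtain ⟨P₁, P₂, hP₁, hP₂, hper⟩ :=
    chatterjee2021_perimeterLaw (d := d) ρ π hρ β hπ hπu hirr ⟨g₀, hg₀c, hg₀ne⟩
  -- the threshold `R₀`: `m C₃ e^{−C₄ R} ≤ e^{−C₄ R/2}` for `R ≥ R₀`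
  obtain ⟨R₀, hR₀1, hR₀⟩ : ∃ R₀ : ℕ, 1 ≤ R₀ ∧ ∀ R : ℕ, R₀ ≤ R →
      (m : ℝ) * (C₃ * Real.exp (-(C₄ * R))) ≤ Real.exp (-(C₄ / 2 * R)) := by
    refine ⟨⌈2 * m * C₃ / C₄⌉₊ + 1, by omega, fun R hR => ?_⟩
    have h1 : 2 * m * C₃ / C₄ ≤ R := (Nat.le_ceil _).trans (by
      have : (⌈2 * (m : ℝ) * C₃ / C₄⌉₊ : ℝ) ≤ R := by exact_mod_cast (by omega : ⌈2 * (m : ℝ) * C₃ / C₄⌉₊ ≤ R)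
      exact this)
    have h2 : (m : ℝ) * C₃ ≤ C₄ / 2 * R := by
      rw [div_le_iff₀ hC₄] at h1
      linarith
    have h3 : (m : ℝ) * C₃ ≤ Real.exp (C₄ / 2 * R) :=
      h2.trans ((le_add_of_nonneg_right zero_le_one).trans (Real.add_one_le_exp _))
    have h4 : (m : ℝ) * (C₃ * Real.exp (-(C₄ * R))) =
        ((m : ℝ) * C₃ * Real.exp (-(C₄ / 2 * R))) * Real.exp (-(C₄ / 2 * R)) := by
      have he : Real.exp (-(C₄ * R)) = Real.exp (-(C₄ / 2 * R)) * Real.exp (-(C₄ / 2 * R)) := by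
        rw [← Real.exp_add]
        congr 1
        ring
      rw [he]
      ring
    rw [h4]
    refine mul_le_of_le_one_left (Real.exp_nonneg _) ?_
    calc (m : ℝ) * C₃ * Real.exp (-(C₄ / 2 * R))
        ≤ Real.exp (C₄ / 2 * R) * Real.exp (-(C₄ / 2 * R)) :=
          mul_le_mul_of_nonneg_right h3 (Real.exp_nonneg _)
      _ = 1 := by rw [← Real.exp_add, add_neg_cancel, Real.exp_zero]
  have hR₀0 : (0 : ℝ) < R₀ := by exact_mod_cast hR₀1
  -- the constants
  set C₁ : ℝ := max ((m : ℝ) ^ 2) P₁ with hC₁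
  set C₂ : ℝ := min (P₂ / n) (min (C₄ / (4 * n)) (P₂ / R₀)) with hC₂
  have hC₁0 : 0 < C₁ := lt_max_of_lt_right hP₁
  have hC₂0 : 0 < C₂ := lt_min (by positivity) (lt_min (by positivity) (by positivity))
  refine ⟨C₁, C₂, hC₁0, hC₂0, fun μ hμ x i j hij R T hR hT => ?_⟩
  haveI : IsProbabilityMeasure μ := hμ.1
  have hRT0 : (0 : ℝ) ≤ (R : ℝ) * T := by positivity
  have conclude : ∀ (P a : ℝ),
      ‖∫ U, (π (walkHolonomy U (rectWalk x i j R T))).trace ∂μ‖ ≤ P * Real.exp (-a) → P ≤ C₁ →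
        C₂ * ((R : ℝ) * T) ≤ a →
          ‖∫ U, (π (walkHolonomy U (rectWalk x i j R T))).trace ∂μ‖ ≤ C₁ * Real.exp (-(C₂ * ((R : ℝ) * T))) :=
    fun P a h hP ha => h.trans (mul_le_mul hP (Real.exp_le_exp.2 (by linarith)) (Real.exp_nonneg _) hC₁0.le)
  have hA_per : ‖∫ U, (π (walkHolonomy U (rectWalk x i j R T))).trace ∂μ‖ ≤
      P₁ * Real.exp (-(P₂ * ((R : ℝ) + T))) := hper μ hμ x i j hij R T hR hT
  by_cases hTn : T < n
  · -- short loops: the perimeter law, decay in `R`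
    refine conclude P₁ (P₂ * ((R : ℝ) + T)) hA_per (le_max_right _ _) ?_
    have h1 : C₂ ≤ P₂ / n := min_le_left _ _
    have hTn' : (T : ℝ) ≤ n := by exact_mod_cast hTn.le
    have h2 : C₂ * ((R : ℝ) * T) ≤ P₂ / n * ((R : ℝ) * T) := mul_le_mul_of_nonneg_right h1 hRT0
    have h3 : P₂ / n * ((R : ℝ) * T) ≤ P₂ * R := by
      rw [div_mul_eq_mul_div, div_le_iff₀ hn0]
      have : P₂ * ((R : ℝ) * T) ≤ P₂ * (R * n) :=
        mul_le_mul_of_nonneg_left (mul_le_mul_of_nonneg_left hTn' (by positivity)) hP₂.le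
      linarith
    have h4 : P₂ * (R : ℝ) ≤ P₂ * ((R : ℝ) + T) := by nlinarith
    linarith
  have hTn' : n ≤ T := not_lt.1 hTn
  by_cases hRR₀ : R₀ ≤ R
  · -- long loops far from the column: the slab bound (12.1)
    set s : ℝ := colSup d ρ π β n R with hs_def
    have hs01 : 0 ≤ s ∧ s ≤ 1 := colSup_nonneg_le_one ρ π hρ hπu β n R
    set q := T / n with hq
    have hq1 : 1 ≤ q := (Nat.le_div_iff_mul_le hn).2 (by simpa using hTn')
    -- the `j = 0` form of the bound, for every DLR state and base point
    have key0 : ∀ (μ' : Measure (LGConfig d G)), μ' ∈ ymGibbsMeasures ρ β → ∀ (x' : Site d) {i' : Fin d},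
        i' ≠ 0 → ‖∫ U, (π (walkHolonomy U (rectWalk x' i' 0 R T))).trace ∂μ'‖ ≤
          (m : ℝ) ^ (q + 2) * s ^ q := fun μ' hμ' x' i' hi' =>
      norm_integral_trace_rect_le ρ π hρ hπ hπu β n hs01.1 hR
        (fun η a b => norm_colKernel_le_colSup ρ π hρ hπu β n R η a b) hμ' x' hi' T
    -- reduce to the `j = 0` form by a coordinate permutation
    have hbound : ‖∫ U, (π (walkHolonomy U (rectWalk x i j R T))).trace ∂μ‖ ≤
        (m : ℝ) ^ (q + 2) * s ^ q := by
      by_cases hj : j = 0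
      · subst hj; exact key0 μ hμ x hij
      · set σ : Equiv.Perm (Fin d) := Equiv.swap (0 : Fin d) j with hσ
        have hσj : σ j = 0 := by rw [hσ, Equiv.swap_apply_right]
        have hσi : σ i ≠ 0 := by
          intro h
          apply hij
          have : i = σ.symm 0 := (Equiv.eq_symm_apply σ).2 h
          rw [this, hσ, Equiv.symm_swap, Equiv.swap_apply_left]
        have hΨ : Measurable (relabelConfig (G := G) (edgePerm σ)) :=
          (relabelConfig (edgePerm σ)).measurable
        have hchange : ∫ U, (π (walkHolonomy U (rectWalk x i j R T))).trace ∂μ =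
            ∫ U, (π (walkHolonomy U (rectWalk (sitePerm σ x) (σ i) (σ j) R T))).trace
              ∂(μ.map (relabelConfig (edgePerm σ))) := by
          rw [integral_map hΨ.aemeasurable (continuous_trace_rect'' π hπ _ _ _ R T).aestronglyMeasurable]
          simp only [walkHolonomy_relabel_edgePerm_rectWalk]
        rw [hchange, hσj]
        exact key0 _ (map_relabel_edgePerm_mem_ymGibbsMeasures ρ hρ β σ hμ) _ hσi
    -- `m^{q+2} s^q = m² (m s)^q ≤ m² e^{−C₄ R q/2}`
    have hms : (m : ℝ) * s ≤ Real.exp (-(C₄ / 2 * R)) :=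
      (mul_le_mul_of_nonneg_left (hcol R hR) hmpos.le).trans (hR₀ R hRR₀)
    have hms0 : 0 ≤ (m : ℝ) * s := mul_nonneg hmpos.le hs01.1
    have hslab : ‖∫ U, (π (walkHolonomy U (rectWalk x i j R T))).trace ∂μ‖ ≤
        (m : ℝ) ^ 2 * Real.exp (-(C₄ / 2 * R * q)) := by
      refine hbound.trans ?_
      rw [show (m : ℝ) ^ (q + 2) * s ^ q = (m : ℝ) ^ 2 * ((m : ℝ) * s) ^ q by rw [mul_pow, pow_add]; ring,
        show -(C₄ / 2 * R * q) = (q : ℝ) * (-(C₄ / 2 * R)) by ring, Real.exp_nat_mul]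
      exact mul_le_mul_of_nonneg_left (pow_le_pow_left₀ hms0 hms q) (by positivity)
    refine conclude ((m : ℝ) ^ 2) (C₄ / 2 * R * q) hslab (le_max_left _ _) ?_
    -- `C₂ R T ≤ (C₄/(4n)) R T ≤ (C₄/2) R q` since `q ≥ T/(2n)`
    have h1 : C₂ ≤ C₄ / (4 * n) := (min_le_right _ _).trans (min_le_left _ _)
    have hTq : (T : ℝ) ≤ (q : ℝ) * (2 * n) := by
      have hdecomp : n * q + T % n = T := by rw [hq]; exact Nat.div_add_mod T n
      have hmod : T % n < n := Nat.mod_lt T hn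
      have hnq : n ≤ n * q := Nat.le_mul_of_pos_right n hq1
      have hT2 : T ≤ q * (2 * n) := by nlinarith
      exact_mod_cast hT2
    have h2 : C₂ * ((R : ℝ) * T) ≤ C₄ / (4 * n) * ((R : ℝ) * T) := mul_le_mul_of_nonneg_right h1 hRT0
    have h3 : C₄ / (4 * n) * ((R : ℝ) * T) ≤ C₄ / 2 * R * q := by
      rw [div_mul_eq_mul_div, div_le_iff₀ (by positivity)]
      have : C₄ * ((R : ℝ) * T) ≤ C₄ * (R * (q * (2 * n))) :=
        mul_le_mul_of_nonneg_left (mul_le_mul_of_nonneg_left hTq (by positivity)) hC₄.le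
      linarith
    linarith
  · -- long loops close to the column: the perimeter law, decay in `T`
    have hRR₀' : (R : ℝ) ≤ R₀ := by exact_mod_cast (not_le.1 hRR₀).le
    refine conclude P₁ (P₂ * ((R : ℝ) + T)) hA_per (le_max_right _ _) ?_
    have h1 : C₂ ≤ P₂ / R₀ := (min_le_right _ _).trans (min_le_right _ _)
    have h2 : C₂ * ((R : ℝ) * T) ≤ P₂ / R₀ * ((R : ℝ) * T) := mul_le_mul_of_nonneg_right h1 hRT0
    have h3 : P₂ / R₀ * ((R : ℝ) * T) ≤ P₂ * T := by
      rw [div_mul_eq_mul_div, div_le_iff₀ hR₀0]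
      have : P₂ * ((R : ℝ) * T) ≤ P₂ * (R₀ * T) :=
        mul_le_mul_of_nonneg_left (mul_le_mul_of_nonneg_right hRR₀' (by positivity)) hP₂.le
      linarith
    have h4 : P₂ * (T : ℝ) ≤ P₂ * ((R : ℝ) + T) := by nlinarith
    linarith

/-- ★★ **Chatterjee 2021, Theorem 2.4** — discharge of the named fact `chatterjee2021_areaLaw_of_strongExpDecay`
(«exponential decay of correlations under arbitrary boundary conditions implies unbroken center symmetry,
hence Wilson's area law»): the first assertion is the tree's `centreUnbroken_of_hasStrongExpDecayZd` (§12 ¶1),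
the second is `areaLaw_of_hasStrongExpDecayZd` (§12 ¶2 – end). The fact's hypotheses `2 ≤ d`, `G` connected,
`ρ` faithful and unitary are not used (the statement holds for every compact metrisable `G` and continuous `ρ`).
[cite: Chatterjee2021, Thm. 2.4] -/
theorem chatterjee2021_areaLaw_of_strongExpDecay_holds : chatterjee2021_areaLaw_of_strongExpDecay := by
  intro d _ _hd G _ _ _ _ _ _ _ _ _ N ρ hρ _hρinj _hρu β hdecay
  refine ⟨centreUnbroken_of_hasStrongExpDecayZd ρ hρ hdecay, fun m π hπ hπu hirr hg₀ μ hμ => ?_⟩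
  obtain ⟨C₁, C₂, h1, h2, h⟩ := areaLaw_of_hasStrongExpDecayZd ρ π hρ hdecay hπ hπu hirr hg₀
  exact ⟨C₁, C₂, h1, h2, h μ hμ⟩

end Assembly

end Literature.MathematicalPhysics.QuantumLattice

end
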